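import Literature.AlgebraicGeometry.HodgeTheory.HomComplexPushforward
import Literature.Algebra.Homology.CoproductFiniteSupport
import Mathlib.Data.Int.Interval
import HarnessLib

/-!
# The internal Hom complex along a morphism of schemes: the comparison `f_*•𝓗om•(E•, L•) ⟶ 𝓗om•(f_*•E•, f_*•L•)`

Layer `Literature/AlgebraicGeometry/HodgeTheory`; sequel to `HomComplexPushforward.lean`, which treats an ISOMORPHISM `ε` of schemes
(`homComplexPushforwardIso ε E L : ε_*•𝓗om•(E•, L•) ≅ 𝓗om•(ε_*•E•, ε_*•L•)`). For an ARBITRARY morphism of schemes `f : X ⟶ Y` the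
same bookkeeping gives a comparison MORPHISM (restriction of Hom's along `f`, The Stacks Project, Tag 01CM ∕ 0A8H: for
`𝒪_X`-modules `E, L` there is a canonical map `f_*𝓗om(E, L) → 𝓗om(f_*E, f_*L)`), for a BOUNDED first argument `E•`:

* `homBicomplexPushforwardComparison f E L` — the Hom BICOMPLEX comparison `f_*••(𝓗om(E^{-i}, L^q))_{q,i} ⟶ (𝓗om((f_*E)^{-i}, (f_*L)^q))_{q,i}`,
  componentwise the module-level `sheafHomPushforwardComparison f` (`Modules/SheafHomPushforward`, any `f`), a morphism of bicomplexes by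
  its naturality in both variables (`PushforwardIsoUnit.pushforward_map_sheafHomMap_comp_comparison`, `SheafHomPushforwardLeft`);
* `preservesColimit_pushforward_homBicomplex` — for `E•` concentrated in `[a, b]` the coproducts `∐_{q+i=n} 𝓗om(E^{-i}, L^q)` defining the
  total complex are supported on the finite set `-b ≤ i ≤ -a`, hence preserved by the additive `f_*`
  (`Algebra/Homology/CoproductFiniteSupport`), although `f_*` preserves no infinite coproduct in general;
* **`homComplexPushforwardComparison f E L a b : f_*•𝓗om•(E•, L•) ⟶ 𝓗om•(f_*•E•, f_*•L•)`** — `(mapTotalIso f_*)⁻¹` followed by `total.map`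
  of the bicomplex comparison; on summands it IS `sheafHomPushforwardComparison f (E^{-i}) (L^q)`
  (`map_ι_comp_homComplexPushforwardComparison_f`).

Everything is proved; no named facts. NOT here: naturality in `L•` (as a natural transformation `𝓗om•(E•, –) ⋙ f_*• ⟶ f_*• ⋙ 𝓗om•(f_*•E•, –)`
with shifts), the unit and supertrace compatibilities, and invertibility for an isomorphism `f` (that is `homComplexPushforwardIso`).
Motivation: piece (N1′) — `g_*` on `𝓗om•` as a comparison morphism, the `x = 0` summand of the projection-formula decomposition — of
the trace side (Tr) of road №4 of the Hodge programme for an isogeny `g`; nothing here refers to it.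

## References

* The Stacks Project, Tag 01CM (Modules: internal Hom) and More on Algebra, Section «Hom complexes». [StacksProject]
* R. Hartshorne, *Algebraic Geometry* (1977), II §5 pp. 109–110 (sheaf Hom; direct images). [Hartshorne1977]
* C. A. Weibel, *An introduction to homological algebra* (1994), §1.2, 1.2.6; §2.6; 2.7.4–2.7.5. [Weibel1994]
-/

noncomputable section

-- `TopCat.Presheaf`/`Scheme.Modules`/`GradedObject` are not reducible.
set_option backward.isDefEq.respectTransparency false

open CategoryTheory CategoryTheory.Category CategoryTheory.Limits AlgebraicGeometry Opposite
open AlgebraicGeometry.Scheme.Modules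

universe u

namespace Literature.AlgebraicGeometry.HodgeTheory

open Literature.AlgebraicGeometry.Modules Literature.Algebra.Homology

variable {X Y : Scheme.{u}} (f : X ⟶ Y) (E L : CochainComplex X.Modules ℤ)

/-! ## The Hom bicomplex comparison (any `f`, any `E•`) -/

/-- **The Hom bicomplex along `f_*`**: `f_*(𝓗om(E^{-i}, L^q)) ⟶ 𝓗om((f_*E)^{-i}, (f_*L)^q)` componentwise (`sheafHomPushforwardComparison`),
as a morphism of bicomplexes `f_*••(homBicomplex X E L) ⟶ homBicomplex Y (f_*•E) (f_*•L)` — horizontal differentials by naturality in the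
second variable, vertical (signed dual) differentials by naturality in the first variable.
[cite: Hartshorne1977, II §5 pp. 109–110 (the sheaf Hom and direct images f_*)] [cite: StacksProject, Tag 01CM] -/
def homBicomplexPushforwardComparison :
    mapBicomplex (pushforward f) (homBicomplex X E L) ⟶
      homBicomplex Y (((pushforward f).mapHomologicalComplex (ComplexShape.up ℤ)).obj E)
        (((pushforward f).mapHomologicalComplex (ComplexShape.up ℤ)).obj L) where
  f q :=
    { f := fun i => sheafHomPushforwardComparison f (E.X (-i)) (L.X q)
      comm' := fun i i' _ => by
        change sheafHomPushforwardComparison f (E.X (-i)) (L.X q) ≫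
            sheafHomMapLeft (((i').negOnePow : ℤˣ) • (pushforward f).map (E.d (-i') (-i)))
              ((pushforward f).obj (L.X q)) =
          (pushforward f).map (sheafHomMapLeft (((i').negOnePow : ℤˣ) • E.d (-i') (-i)) (L.X q)) ≫
            sheafHomPushforwardComparison f (E.X (-i')) (L.X q)
        rw [sheafHomMapLeft_units_smul, sheafHomMapLeft_units_smul, Units.smul_def, Units.smul_def, Functor.map_zsmul,
          Preadditive.comp_zsmul, Preadditive.zsmul_comp, pushforward_map_sheafHomMapLeft_comp_comparison] }
  comm' q q' _ := by
    refine HomologicalComplex.hom_ext _ _ fun i => ?_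
    change sheafHomPushforwardComparison f (E.X (-i)) (L.X q) ≫
        sheafHomMap ((pushforward f).obj (E.X (-i))) ((pushforward f).map (L.d q q')) =
      (pushforward f).map (sheafHomMap (E.X (-i)) (L.d q q')) ≫ sheafHomPushforwardComparison f (E.X (-i)) (L.X q')
    exact (pushforward_map_sheafHomMap_comp_comparison f (E.X (-i)) (L.d q q')).symm

/-- Components of the bicomplex comparison. [cite: StacksProject, Tag 01CM] -/
theorem homBicomplexPushforwardComparison_f_f (q i : ℤ) :
    ((homBicomplexPushforwardComparison f E L).f q).f i = sheafHomPushforwardComparison f (E.X (-i)) (L.X q) := rfl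

/-! ## Bounded `E•`: `f_*` preserves the coproducts of the total complex -/

section Bounded

/-- The terms `𝓗om(E^{-i}, L^q)` of the Hom bicomplex vanish for `-i` outside `[a, b]` when `E•` is concentrated in `[a, b]`.
[cite: Weibel1994, 2.7.4–2.7.5 (Hom double complex)] -/
theorem isZero_homBicomplex_of_lt_or_lt (a b : ℤ) [E.IsStrictlyGE a] [E.IsStrictlyLE b] (q i : ℤ)
    (hi : i < -b ∨ -a < i) :
    IsZero ((homBicomplex X E L).toGradedObject (q, i)) := by
  change IsZero (sheafHom (E.X (-i)) (L.X q))
  rcases hi with hi | hi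
  · exact isZero_sheafHom_of_isZero (E.isZero_of_isStrictlyLE b (-i) (by omega)) _
  · exact isZero_sheafHom_of_isZero (E.isZero_of_isStrictlyGE a (-i) (by omega)) _

/-- **`f_*` preserves the coproducts `∐_{q+i=n} 𝓗om(E^{-i}, L^q)` of the total complex for `E•` bounded**: the family is supported on
the finite set `-b ≤ i ≤ -a` (`q = n - i`), and an additive functor preserves coproducts with finite support
(`preservesColimit_discrete_of_isZero_of_notMem`). [cite: Weibel1994, §1.2, 1.2.6 and §2.6] -/
theorem preservesColimit_pushforward_homBicomplex (a b : ℤ) [E.IsStrictlyGE a] [E.IsStrictlyLE b] (n : ℤ) :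
    PreservesColimit (Discrete.functor ((homBicomplex X E L).toGradedObject.mapObjFun
      (ComplexShape.π (ComplexShape.up ℤ) (ComplexShape.up ℤ) (ComplexShape.up ℤ)) n)) (pushforward f) := by
  classical
  let p := ComplexShape.π (ComplexShape.up ℤ) (ComplexShape.up ℤ) (ComplexShape.up ℤ)
  refine preservesColimit_discrete_of_isZero_of_notMem (pushforward f) _
    (((Finset.Icc (-b) (-a)).image fun i : ℤ => (n - i, i)).subtype (· ∈ p ⁻¹' {n})) fun x hx => ?_
  obtain ⟨⟨q, i⟩, hqi⟩ := x
  have hn : q + i = n := hqi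
  change IsZero ((homBicomplex X E L).toGradedObject (q, i))
  apply isZero_homBicomplex_of_lt_or_lt E L a b q i
  by_contra hcon
  obtain ⟨h1, h2⟩ := not_or.mp hcon
  rw [not_lt] at h1 h2
  apply hx
  rw [Finset.mem_subtype, Finset.mem_image]
  exact ⟨i, Finset.mem_Icc.mpr ⟨h1, h2⟩, Prod.ext (by change n - i = q; omega) rfl⟩

/-- **The comparison of internal Hom complexes along `f`**: `f_*•𝓗om•(E•, L•) ⟶ 𝓗om•(f_*•E•, f_*•L•)` for `E•` bounded — the inverse of
the total-complex comparison `mapTotalIso f_*` (an isomorphism because `f_*` preserves the finitely supported coproducts involved) followed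
by `total.map` of the bicomplex comparison. [cite: StacksProject, Tag 01CM (f_*𝓗om(E, L) → 𝓗om(f_*E, f_*L))]
[cite: Weibel1994, §1.2, 1.2.6 and 2.7.4–2.7.5] -/
def homComplexPushforwardComparison (a b : ℤ) [E.IsStrictlyGE a] [E.IsStrictlyLE b] :
    ((pushforward f).mapHomologicalComplex (ComplexShape.up ℤ)).obj (homComplex X E L) ⟶
      homComplex Y (((pushforward f).mapHomologicalComplex (ComplexShape.up ℤ)).obj E)
        (((pushforward f).mapHomologicalComplex (ComplexShape.up ℤ)).obj L) :=
  haveI := fun n => preservesColimit_pushforward_homBicomplex f E L a b n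
  (mapTotalIso (pushforward f) (homBicomplex X E L) (ComplexShape.up ℤ)).inv ≫
    HomologicalComplex₂.total.map (homBicomplexPushforwardComparison f E L) (ComplexShape.up ℤ)

/-- **On summands**: `f_*(ι_{q,i}) ≫ κ•_n = (f_*𝓗om(E^{-i}, L^q) → 𝓗om(f_*E^{-i}, f_*L^q)) ≫ ι'_{q,i}` — the comparison of Hom complexes is the
module-level `sheafHomPushforwardComparison` summand by summand. [cite: StacksProject, Tag 01CM] [cite: Weibel1994, §1.2, 1.2.6] -/
theorem map_ι_comp_homComplexPushforwardComparison_f (a b : ℤ) [E.IsStrictlyGE a] [E.IsStrictlyLE b] (q i n : ℤ)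
    (h : q + i = n) :
    (pushforward f).map (HomComplex.ι X E L q i n h) ≫ (homComplexPushforwardComparison f E L a b).f n =
      sheafHomPushforwardComparison f (E.X (-i)) (L.X q) ≫
        HomComplex.ι Y (((pushforward f).mapHomologicalComplex (ComplexShape.up ℤ)).obj E)
          (((pushforward f).mapHomologicalComplex (ComplexShape.up ℤ)).obj L) q i n h := by
  haveI := fun n => preservesColimit_pushforward_homBicomplex f E L a b n
  rw [homComplexPushforwardComparison, HomologicalComplex.comp_f]
  have hι : (pushforward f).map (HomComplex.ι X E L q i n h) ≫
      (mapTotalIso (pushforward f) (homBicomplex X E L) (ComplexShape.up ℤ)).inv.f n =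
      (mapBicomplex (pushforward f) (homBicomplex X E L)).ιTotal (ComplexShape.up ℤ) q i n h := by
    rw [← ιTotal_mapTotalIso_hom (pushforward f) (homBicomplex X E L) (ComplexShape.up ℤ) q i n h, Category.assoc,
      ← HomologicalComplex.comp_f, Iso.hom_inv_id, HomologicalComplex.id_f, Category.comp_id]
  rw [← Category.assoc, hι, HomologicalComplex₂.ιTotal_map, homBicomplexPushforwardComparison_f_f]

end Bounded

/-! ## Naturality in the second variable (appended) -/

section Naturality

/-- Maps out of `f_*(𝓗om•(E•, L•)^n)` are determined on the summands `f_*(ι_{q,i})` (`f_*` preserves the finitely supported coproduct,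
`preservesColimit_pushforward_homBicomplex`). [cite: Weibel1994, §1.2, 1.2.6] -/
theorem pushforward_ι_hom_ext (a b : ℤ) [E.IsStrictlyGE a] [E.IsStrictlyLE b] {n : ℤ} {T : Y.Modules} {φ ψ : (pushforward f).obj ((homComplex X E L).X n) ⟶ T}
    (h : ∀ (q i : ℤ) (hqi : q + i = n),
      (pushforward f).map (HomComplex.ι X E L q i n hqi) ≫ φ = (pushforward f).map (HomComplex.ι X E L q i n hqi) ≫ ψ) :
    φ = ψ := by
  haveI := fun n => preservesColimit_pushforward_homBicomplex f E L a b n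
  rw [← cancel_epi ((mapTotalIso (pushforward f) (homBicomplex X E L) (ComplexShape.up ℤ)).hom.f n)]
  apply HomologicalComplex₂.total.hom_ext
  intro q i hqi
  simp only [← Category.assoc]
  rw [ιTotal_mapTotalIso_hom]
  exact h q i hqi

/-- **Naturality of the comparison in `L•`**: `f_*•(𝓗om•(E•, φ)) ≫ κ_{E,L'} = κ_{E,L} ≫ 𝓗om•(f_*•E•, f_*•φ)` — on the summand `𝓗om(E^{-i}, L^q)`
both sides are `f_*(φ^q ∘ –)` followed by the module-level comparison (`pushforward_map_sheafHomMap_comp_comparison`). So the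
comparisons assemble into a natural transformation `𝓗om•(E•, –) ⋙ f_*• ⟶ f_*• ⋙ 𝓗om•(f_*•E•, –)`.
[cite: StacksProject, Tag 01CM] [cite: Weibel1994, 2.7.4–2.7.5] -/
theorem homComplexPushforwardComparison_naturality (a b : ℤ) [E.IsStrictlyGE a] [E.IsStrictlyLE b]
    {L L' : CochainComplex X.Modules ℤ} (φ : L ⟶ L') :
    ((pushforward f).mapHomologicalComplex (ComplexShape.up ℤ)).map (HomComplex.map X E φ) ≫
        homComplexPushforwardComparison f E L' a b =
      homComplexPushforwardComparison f E L a b ≫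
        HomComplex.map Y (((pushforward f).mapHomologicalComplex (ComplexShape.up ℤ)).obj E)
          (((pushforward f).mapHomologicalComplex (ComplexShape.up ℤ)).map φ) := by
  refine HomologicalComplex.hom_ext _ _ fun n => pushforward_ι_hom_ext f E L a b fun q i hqi => ?_
  rw [HomologicalComplex.comp_f, HomologicalComplex.comp_f, Functor.mapHomologicalComplex_map_f,
    ← Functor.map_comp_assoc, HomComplex.ι_map, Functor.map_comp_assoc, map_ι_comp_homComplexPushforwardComparison_f,
    reassoc_of% (map_ι_comp_homComplexPushforwardComparison_f f E L a b q i n hqi), HomComplex.ι_map,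
    Functor.mapHomologicalComplex_map_f, ← Category.assoc, ← Category.assoc,
    pushforward_map_sheafHomMap_comp_comparison f (E.X (-i)) (φ.f q)]
  rfl

end Naturality

end Literature.AlgebraicGeometry.HodgeTheory

end
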